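import Summits.CriticalPhenomena.PercolationContinuityZ3.Theorems.PercNearOneGluingNoHeavyPcintMeanMemFast
import HarnessLib

/-!
# PCINT lane, reduced-state B3m certificates (bond), fast kernel format: denotation, geometry, probes, step, symmetries

Cell `prim-pcint` (PAPER-2 track (iii)), seat `prim-pcint-2` (gen 11); support file (`--supports stmt-CriticalPhenomena-4575`).
Does NOT build on p205010.  The SOUNDNESS bridges of the computable layer `…PcintMeanMemFast` that concern geometry:
the denotation `BondF.toMF` of a fast kernel state (shifted natural coordinates ↦ sites of `ℤ^d`), the coordinate lemmas for
`BondF.addU` / `BondF.unitF` / `BondF.l1F`, the probe lemmas for the local map (`BondF.probe_hit`: a hit is a listed entry with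
the probed code, hence — `code64_inj` — the probed site; `BondF.probe_self`: the self-check gives completeness; whence
`exists_of_ageAt`, `ageAt_eq_of_mem`, `ageAt_eq_zero`, `nbAge_of_adj`, `exists_of_nbAge` on well-formed self-checked states), and the step bridge **`BondF.mstep_toMF`** (`mstep τ (toMF L) a = (mstepF L a).map toMF`).  The symmetry bridge and the
unit-count bridges are in `…PcintMeanMemFastUnits`, the certificate theorem in `…PcintMeanMemFastCert`.
-/

namespace Summit.CriticalPhenomena.PercolationContinuityZ3.Theorems.Pcint

open Finset Literature.Probability.Percolation Literature.Probability.LatticeModels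

namespace BondF

open NawK (letters letterIdx mem_letters nodup_letters spermKL)

variable {d : ℕ}

/-! ### Coordinates -/

/-- `addU` preserves length. [folklore] -/
@[simp] theorem length_addU : ∀ (v : List ℕ) (i : ℕ) (up : Bool), (addU v i up).length = v.length
  | [], _, _ => rfl
  | _ :: _, 0, _ => rfl
  | _ :: v, i + 1, up => by simp [addU, length_addU v i up]

/-- `addU` at the changed coordinate. [folklore] -/
theorem getD_addU_self : ∀ (v : List ℕ) (i : ℕ) (up : Bool), i < v.length →
    (addU v i up).getD i 0 = if up then v.getD i 0 + 1 else v.getD i 0 - 1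
  | [], _, _, h => by simp at h
  | x :: v, 0, up, _ => by cases up <;> simp [addU]
  | x :: v, i + 1, up, h => by
    simp only [addU, List.getD_cons_succ]
    exact getD_addU_self v i up (by simpa using h)

/-- `addU` off the changed coordinate. [folklore] -/
theorem getD_addU_of_ne : ∀ (v : List ℕ) (i k : ℕ) (up : Bool), k ≠ i → (addU v i up).getD k 0 = v.getD k 0
  | [], _, _, _, _ => rfl
  | x :: v, 0, k, up, h => by
    obtain ⟨k', rfl⟩ : ∃ k', k = k' + 1 := ⟨k - 1, by omega⟩
    simp [addU]
  | x :: v, i + 1, 0, up, _ => by simp [addU]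
  | x :: v, i + 1, k + 1, up, h => by
    simp only [addU, List.getD_cons_succ]
    exact getD_addU_of_ne v i k up (by omega)

/-- Lower bounds survive one move, minus one. [folklore] -/
theorem addU_ge {n : ℕ} : ∀ (v : List ℕ) (i : ℕ) (up : Bool), (∀ x ∈ v, n + 1 ≤ x) → ∀ x ∈ addU v i up, n ≤ x
  | [], _, _, _, x, hx => by simp [addU] at hx
  | y :: v, 0, up, h, x, hx => by
    simp only [addU, List.mem_cons] at hx
    rcases hx with rfl | hx
    · have := h y (by simp); cases up <;> simp <;> omega
    · have := h x (by simp [hx]); omega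
  | y :: v, i + 1, up, h, x, hx => by
    simp only [addU, List.mem_cons] at hx
    rcases hx with rfl | hx
    · have := h x (by simp); omega
    · exact addU_ge v i up (fun z hz => h z (by simp [hz])) x hx

/-- Upper bounds survive one move, plus one. [folklore] -/
theorem addU_le {m : ℕ} : ∀ (v : List ℕ) (i : ℕ) (up : Bool), (∀ x ∈ v, x ≤ m) → ∀ x ∈ addU v i up, x ≤ m + 1
  | [], _, _, _, x, hx => by simp [addU] at hx
  | y :: v, 0, up, h, x, hx => by
    simp only [addU, List.mem_cons] at hx
    rcases hx with rfl | hx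
    · have := h y (by simp); cases up <;> simp <;> omega
    · have := h x (by simp [hx]); omega
  | y :: v, i + 1, up, h, x, hx => by
    simp only [addU, List.mem_cons] at hx
    rcases hx with rfl | hx
    · have := h x (by simp); omega
    · exact addU_le v i up (fun z hz => h z (by simp [hz])) x hx

/-- The site of `ℤ^d` denoted by shifted natural coordinates. [folklore] -/
def toSiteF (B : ℕ) (v : List ℕ) : Site d := fun i => ((v.getD i 0 : ℕ) : ℤ) - B

/-- `getD` inside the list is `getElem`. [folklore] -/
theorem getD_eq_getElem {l : List ℕ} {i : ℕ} (h : i < l.length) : l.getD i 0 = l[i] := by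
  rw [List.getD_eq_getElem?_getD, List.getElem?_eq_getElem h, Option.getD_some]

/-- An in-range coordinate is a member. [folklore] -/
theorem getD_mem {l : List ℕ} {i : ℕ} (h : i < l.length) : l.getD i 0 ∈ l := by
  rw [getD_eq_getElem h]; exact List.getElem_mem h

/-- **One move is one unit step** (no truncation when the coordinates are positive). [folklore] -/
theorem toSiteF_addU {B : ℕ} {v : List ℕ} (hv : v.length = d) (h1 : ∀ x ∈ v, 1 ≤ x) (a : Fin d × Bool) :
    (toSiteF B (addU v a.1.1 a.2) : Site d) = toSiteF B v + stepVec a := by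
  funext i
  simp only [toSiteF, Pi.add_apply]
  by_cases hi : i = a.1
  · rw [hi, getD_addU_self v a.1.1 a.2 (by rw [hv]; exact a.1.2), stepVec_apply_fst]
    have h1i : 1 ≤ v.getD a.1.1 0 := h1 _ (getD_mem (by rw [hv]; exact a.1.2))
    cases a.2
    · simp only [Bool.false_eq_true, ↓reduceIte]; push_cast [Nat.cast_sub h1i]; ring
    · simp only [↓reduceIte]; push_cast; ring
  · rw [getD_addU_of_ne v a.1.1 i.1 a.2 (fun h => hi (Fin.ext h)), stepVec_apply_of_ne a hi, add_zero]

/-- The shifted origin denotes the origin. [folklore] -/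
theorem toSiteF_origF (B : ℕ) : (toSiteF B (origF d B) : Site d) = 0 := by
  funext i
  have h : (origF d B).getD i.1 0 = B := by
    rw [getD_eq_getElem (by simp [origF])]; simp [origF]
  show ((origF d B).getD i.1 0 : ℤ) - B = 0
  rw [h, sub_self]

/-- The shifted unit site denotes the unit step. [folklore] -/
theorem toSiteF_unitF {B : ℕ} (hB : 1 ≤ B) (a : Fin d × Bool) : (toSiteF B (unitF d B a) : Site d) = stepVec a := by
  rw [unitF, toSiteF_addU (by simp [origF]) (fun x hx => by unfold origF at hx; rw [List.eq_of_mem_replicate hx]; exact hB) a,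
    toSiteF_origF, zero_add]

/-- `toSiteF` is injective on lists of length `d`. [folklore] -/
theorem toSiteF_inj {B : ℕ} {v w : List ℕ} (hv : v.length = d) (hw : w.length = d)
    (h : (toSiteF B v : Site d) = toSiteF B w) : v = w := by
  refine List.ext_getElem (hv.trans hw.symm) fun i h1 h2 => ?_
  have := congrFun h ⟨i, hv ▸ h1⟩
  simp only [toSiteF, sub_left_inj, Nat.cast_inj] at this
  rwa [getD_eq_getElem h1, getD_eq_getElem h2] at this

/-- The coordinate distance from `B`. [folklore] -/
theorem natAbs_sub_eq (B x : ℕ) : ((x : ℤ) - B).natAbs = (if B ≤ x then x - B else B - x) := by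
  split_ifs with h
  · rw [show (x : ℤ) - B = ((x - B : ℕ) : ℤ) by push_cast [Nat.cast_sub h]; ring, Int.natAbs_natCast]
  · rw [show (x : ℤ) - B = -((B - x : ℕ) : ℤ) by push_cast [Nat.cast_sub (not_le.1 h).le]; ring, Int.natAbs_neg,
      Int.natAbs_natCast]

/-- **The kernel `ℓ¹` norm is the `ℓ¹` norm.** [folklore] -/
theorem l1F_eq (d : ℕ) {B : ℕ} {v : List ℕ} (hv : v.length = d) : l1 (toSiteF B v : Site d) = l1F B v := by
  subst hv
  have e1 : ∀ u : List ℕ, l1F B u = (u.map fun x => if B ≤ x then x - B else B - x).sum := by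
    intro u
    induction u with
    | nil => rfl
    | cons x u ih => rw [l1F, ih, List.map_cons, List.sum_cons]
  rw [e1, l1, ← List.sum_ofFn]
  congr 1
  apply List.ext_getElem (by simp)
  intro i h1 h2
  simp only [List.getElem_ofFn, List.getElem_map, toSiteF]
  rw [getD_eq_getElem (by simpa using h1), natAbs_sub_eq]

/-! ### Denotation of states -/

/-- The dangerous-set state denoted by a fast kernel state. [folklore] -/
def toMF (B : ℕ) (L : FState) : MState d := (L.map fun e => ((toSiteF B e.1 : Site d), e.2)).toFinset

/-- Membership in the denoted state. [folklore] -/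
theorem mem_toMF {B : ℕ} {L : FState} {q : Site d × ℕ} :
    q ∈ (toMF B L : MState d) ↔ ∃ e ∈ L, ((toSiteF B e.1 : Site d), e.2) = q := by
  simp [toMF]

/-- What well-formedness says. [folklore] -/
theorem WFF_spec {B : ℕ} {L : FState} (h : WFF d B L = true) :
    ∀ e ∈ L, e.1.length = d ∧ 1 ≤ e.2 ∧ ∀ x ∈ e.1, 2 ≤ x ∧ x + 2 ≤ 2 * B := by
  unfold WFF at h
  simp only [Bool.and_eq_true, List.all_eq_true, beq_iff_eq, decide_eq_true_eq] at h
  exact fun e he => ⟨(h e he).1.1, (h e he).1.2, (h e he).2⟩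

/-- One move changes the `ℓ¹` norm by at most one. [folklore] -/
theorem l1F_addU_le {B : ℕ} : ∀ (v : List ℕ) (i : ℕ) (up : Bool), l1F B (addU v i up) ≤ l1F B v + 1
  | [], _, _ => by simp [addU, l1F]
  | x :: v, 0, up => by
    cases up <;> simp only [addU, l1F, Bool.false_eq_true, ↓reduceIte] <;> split_ifs <;> omega
  | x :: v, i + 1, up => by
    simp only [addU, l1F]
    have := l1F_addU_le (B := B) v i up
    omega

/-- The shifted origin has norm `0`. [folklore] -/
theorem l1F_origF (d B : ℕ) : l1F B (origF d B) = 0 := by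
  unfold origF
  induction d with
  | zero => rfl
  | succ n ih => rw [List.replicate_succ, l1F, ih]; simp

/-- Coordinates of the shifted unit site: length `d`, within `1` of `B`, norm `≤ 1`. [folklore] -/
theorem unitF_spec {B : ℕ} (hB : 1 ≤ B) (a : Fin d × Bool) :
    (unitF d B a).length = d ∧ (∀ x ∈ unitF d B a, B - 1 ≤ x ∧ x ≤ B + 1) ∧ l1F B (unitF d B a) ≤ 1 := by
  refine ⟨by simp [unitF, origF], fun x hx => ⟨?_, ?_⟩, ?_⟩
  · exact addU_ge _ _ _ (fun y hy => by unfold origF at hy; rw [List.eq_of_mem_replicate hy]; omega) x hx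
  · exact addU_le _ _ _ (fun y hy => by unfold origF at hy; rw [List.eq_of_mem_replicate hy]) x hx
  · have := l1F_addU_le (B := B) (origF d B) a.1.1 a.2
    rw [l1F_origF] at this
    exact this

/-! ### Probes -/

/-- `code64` is injective on sites with coordinates `< 64`. [folklore] -/
theorem code64_inj : ∀ {v w : List ℕ}, v.length = w.length → (∀ x ∈ v, x < 64) → (∀ x ∈ w, x < 64) →
    code64 v = code64 w → v = w
  | [], [], _, _, _, _ => rfl
  | [], _ :: _, h, _, _, _ => by simp at h
  | _ :: _, [], h, _, _, _ => by simp at h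
  | x :: v, y :: w, hl, hv, hw, h => by
    simp only [code64] at h
    have hx := hv x (by simp)
    have hy := hw y (by simp)
    have h1 : x = y := by omega
    have h2 : code64 v = code64 w := by omega
    rw [h1, code64_inj (by simpa using hl) (fun z hz => hv z (by simp [hz])) (fun z hz => hw z (by simp [hz])) h2]

/-- Membership in the near list. [folklore] -/
theorem mem_nearL {B : ℕ} {L : FState} {x : ℕ × ℕ × ℕ} :
    x ∈ nearL B L ↔ ∃ e ∈ L, l1F B e.1 ≤ 3 ∧ (code64 e.1, cell7 B e.1, e.2) = x := by
  unfold nearL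
  rw [List.mem_filterMap]
  constructor
  · rintro ⟨e, he, h⟩
    by_cases hc : l1F B e.1 ≤ 3
    · rw [if_pos hc, Option.some.injEq] at h; exact ⟨e, he, hc, h⟩
    · rw [if_neg hc] at h; exact absurd h (by simp)
  · rintro ⟨e, he, hc, h⟩
    exact ⟨e, he, by rw [if_pos hc, h]⟩

/-- A nonzero probe names a listed near entry with the probed code (the hit is re-verified, so no property of the directory
is needed). [folklore] -/
theorem probe_hit {P : LMap} {cw : ℕ × ℕ} {g : ℕ} (h : probe P cw = g) (hg : g ≠ 0) :
    ∃ x ∈ P.2.1, x.1 = cw.1 ∧ x.2.2 = g := by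
  unfold probe at h
  split at h
  · exact absurd h.symm hg
  · split at h
    · rename_i e hge
      split_ifs at h with hc
      · exact ⟨e, List.mem_of_getElem? hge, by simpa using hc, h⟩
      · exact absurd h.symm hg
    · exact absurd h.symm hg

/-- The self-check: every near entry is found by its own probe. [folklore] -/
theorem probe_self {P : LMap} (h : selfOK P = true) {x : ℕ × ℕ × ℕ} (hx : x ∈ P.2.1) :
    probe P (x.1, x.2.1) = x.2.2 := by
  unfold selfOK at h
  rw [List.all_eq_true] at h
  simpa using h x hx

section Probes

variable {B kc : ℕ} {L : FState} (hL : WFF d B L = true) (hself : selfOK (locOf B kc L) = true) (hB' : B ≤ 32)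
include hL

include hB' in
/-- A probe that returns a nonzero age: that age is remembered at the site. [folklore] -/
theorem exists_of_ageAt {w : List ℕ} (hw : w.length = d) (hw64 : ∀ x ∈ w, x < 64) {g : ℕ}
    (h : ageAt B (locOf B kc L) w = g) (hg : g ≠ 0) : ∃ e ∈ L, e.1 = w ∧ e.2 = g := by
  have hall := WFF_spec hL
  obtain ⟨x, hx, hx1, hx2⟩ := probe_hit h hg
  obtain ⟨e, he, -, rfl⟩ := mem_nearL.1 hx
  refine ⟨e, he, code64_inj ((hall e he).1.trans hw.symm) (fun z hz => ?_) hw64 hx1, hx2⟩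
  have := ((hall e he).2.2 z hz).2; omega

omit hL in
include hself in
/-- A probe at a near remembered site returns its age. [folklore] -/
theorem ageAt_eq_of_mem {e : List ℕ × ℕ} (he : e ∈ L) (hnear : l1F B e.1 ≤ 3) : ageAt B (locOf B kc L) e.1 = e.2 :=
  probe_self hself (P := locOf B kc L) (mem_nearL.2 ⟨e, he, hnear, rfl⟩)

include hself in
/-- A probe that returns `0` at a near site: the site is not remembered. [folklore] -/
theorem ageAt_eq_zero {w : List ℕ} (h : ageAt B (locOf B kc L) w = 0) (hw3 : l1F B w ≤ 3) : ∀ e ∈ L, e.1 ≠ w := by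
  intro e he hew
  have h1 := ageAt_eq_of_mem hself he (by rw [hew]; exact hw3)
  rw [hew, h] at h1
  have := (WFF_spec hL e he).2.1
  omega

end Probes

/-- The opposite letter is minus the step. [folklore] -/
theorem stepVec_not (a : Fin d × Bool) : stepVec (a.1, !a.2) = -stepVec (d := d) a := by
  funext i
  by_cases hi : i = a.1
  · subst hi
    rw [Pi.neg_apply, stepVec_apply_fst, show (a.1, !a.2).1 = a.1 from rfl, stepVec_apply_fst]
    cases a.2 <;> simp
  · rw [Pi.neg_apply, stepVec_apply_of_ne (a.1, !a.2) (show i ≠ (a.1, !a.2).1 from hi), stepVec_apply_of_ne a hi, neg_zero]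

section Geometry

variable {B kc : ℕ} {L : FState} (hL : WFF d B L = true) (hself : selfOK (locOf B kc L) = true) (hB' : B ≤ 32)
include hL

omit hL in
/-- An adjacent site (positive coordinates at the base) is one move away, as a list. [folklore] -/
theorem exists_letter_of_adj {w v : List ℕ} (hw : w.length = d) (hw1 : ∀ x ∈ w, 1 ≤ x) (hv : v.length = d)
    (hadj : (zdGraph d).Adj (toSiteF B w : Site d) (toSiteF B v)) : ∃ k : Fin d × Bool, v = addU w k.1.1 k.2 := by
  obtain ⟨k, hk⟩ := (zdGraph_adj_iff_stepVec _ _).1 hadj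
  rw [← toSiteF_addU hw hw1 k] at hk
  exact ⟨k, toSiteF_inj hv (by rw [length_addU, hw]) hk⟩

include hself in
/-- **Probes are complete**: on a well-formed, self-checked state, a remembered site adjacent to a probed site of norm `≤ 2`
(positive coordinates) is seen, with its age, by the probe in its direction. [folklore] -/
theorem nbAge_of_adj {w : List ℕ} (hw : w.length = d) (hw1 : ∀ x ∈ w, 1 ≤ x) (hw2 : l1F B w ≤ 2)
    {e : List ℕ × ℕ} (he : e ∈ L) (hadj : (zdGraph d).Adj (toSiteF B w : Site d) (toSiteF B e.1)) :
    ∃ k : Fin d × Bool, e.1 = addU w k.1.1 k.2 ∧ nbAge B (locOf B kc L) w k = e.2 := by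
  obtain ⟨k, hk⟩ := exists_letter_of_adj hw hw1 (WFF_spec hL e he).1 hadj
  refine ⟨k, hk, ?_⟩
  rw [nbAge, ← hk]
  exact ageAt_eq_of_mem hself he (by rw [hk]; have := l1F_addU_le (B := B) w k.1.1 k.2; omega)

include hB' in
/-- **Probes are sound**: a nonzero probe is the age of a remembered site adjacent to the probed site. [folklore] -/
theorem exists_of_nbAge {w : List ℕ} (hw : w.length = d) (hw1 : ∀ x ∈ w, 1 ≤ x) (hw62 : ∀ x ∈ w, x ≤ 62) {k : Fin d × Bool}
    {g : ℕ} (h : nbAge B (locOf B kc L) w k = g) (hg : g ≠ 0) :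
    ∃ e ∈ L, e.1 = addU w k.1.1 k.2 ∧ e.2 = g ∧ (zdGraph d).Adj (toSiteF B e.1 : Site d) (toSiteF B w) := by
  obtain ⟨e, he, he1, he2⟩ := exists_of_ageAt hL hB' (by rw [length_addU, hw])
    (fun x hx => by have := addU_le _ _ _ hw62 x hx; omega) h hg
  refine ⟨e, he, he1, he2, ?_⟩
  rw [he1, toSiteF_addU hw hw1 k]
  exact ((zdGraph_adj_iff_stepVec _ _).2 ⟨k, rfl⟩).symm

include hself in
/-- An absent probe at a near site: no remembered site there. [folklore] -/
theorem forall_ne_of_ageAt {w : List ℕ} (hw : w.length = d) (hw3 : l1F B w ≤ 3) (h : ageAt B (locOf B kc L) w = 0) :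
    ∀ q ∈ (toMF B L : MState d), q.1 ≠ toSiteF B w := by
  intro q hq hqw
  obtain ⟨e, he, rfl⟩ := mem_toMF.1 hq
  exact ageAt_eq_zero hL hself h hw3 e he (toSiteF_inj (WFF_spec hL e he).1 hw hqw)

end Geometry

/-! ### The step -/

/-- The kernel rejection test fires iff the new vertex is a remembered site. [folklore] -/
theorem any_reject_iff {B : ℕ} {L : FState} (hL : WFF d B L = true) (hB : 1 ≤ B) (a : Fin d × Bool) :
    (L.any fun e => e.1 == unitF d B a) = true ↔ ∃ q ∈ (toMF B L : MState d), q.1 = stepVec a := by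
  have hall := WFF_spec hL
  rw [List.any_eq_true]
  constructor
  · rintro ⟨e, he, h⟩
    rw [beq_iff_eq] at h
    exact ⟨_, mem_toMF.2 ⟨e, he, rfl⟩, by simp only; rw [h, toSiteF_unitF hB]⟩
  · rintro ⟨q, hq, h⟩
    obtain ⟨e, he, rfl⟩ := mem_toMF.1 hq
    refine ⟨e, he, ?_⟩
    rw [beq_iff_eq]
    exact toSiteF_inj (hall e he).1 (by simp [unitF, origF]) (by rw [toSiteF_unitF hB]; exact h)

/-- **The fast kernel step is the dangerous-set step.** [folklore] -/
theorem mstep_toMF {B τ : ℕ} {L : FState} (hL : WFF d B L = true) (hB : 1 ≤ B) (a : Fin d × Bool) :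
    mstep τ (toMF B L : MState d) a = (mstepF d B τ L a).map (toMF B) := by
  have hall := WFF_spec hL
  have h1 : ∀ e ∈ L, ∀ x ∈ e.1, 1 ≤ x := fun e he x hx => by have := ((hall e he).2.2 x hx).1; omega
  have hshift : ∀ e ∈ L, (toSiteF B (addU e.1 a.1.1 (!a.2)) : Site d) = toSiteF B e.1 - stepVec a := fun e he => by
    rw [toSiteF_addU (hall e he).1 (h1 e he) (a.1, !a.2), stepVec_not, sub_eq_add_neg]
  unfold mstep mstepF
  by_cases hrej : (L.any fun e => e.1 == unitF d B a) = true
  · rw [if_pos hrej, Option.map_none, if_pos ((any_reject_iff hL hB a).1 hrej)]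
  · rw [if_neg hrej, if_neg (fun h => hrej ((any_reject_iff hL hB a).2 h)), Option.map_some]
    congr 1
    ext q
    rw [Finset.mem_insert, Finset.mem_filter, Finset.mem_image, mem_toMF]
    constructor
    · rintro (rfl | ⟨⟨q', hq', rfl⟩, hjτ, hl⟩)
      · exact ⟨(unitF d B (a.1, !a.2), 1), List.mem_cons.2 (Or.inl rfl), by rw [toSiteF_unitF hB, stepVec_not]⟩
      · obtain ⟨e, he, rfl⟩ := mem_toMF.1 hq'
        simp only at hjτ hl
        refine ⟨(addU e.1 a.1.1 (!a.2), e.2 + 1), List.mem_cons.2 (Or.inr (List.mem_filterMap.2 ⟨e, he, ?_⟩)), ?_⟩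
        · rw [if_pos]
          refine ⟨hjτ, ?_⟩
          rw [← l1F_eq d (by rw [length_addU]; exact (hall e he).1), hshift e he]
          exact hl
        · simp only
          rw [hshift e he]
    · rintro ⟨e, he, rfl⟩
      rcases List.mem_cons.1 he with rfl | he
      · left; simp only; rw [toSiteF_unitF hB, stepVec_not]
      · right
        obtain ⟨y, hy, hye⟩ := List.mem_filterMap.1 he
        split_ifs at hye with hcond
        cases hye
        refine ⟨⟨(toSiteF B y.1, y.2), mem_toMF.2 ⟨y, hy, rfl⟩, ?_⟩, hcond.1, ?_⟩
        · simp only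
          rw [hshift y hy]
        · have := hcond.2
          show l1 (toSiteF B (addU y.1 a.1.1 (!a.2)) : Site d) ≤ τ - (y.2 + 1)
          rwa [l1F_eq d (by rw [length_addU]; exact (hall y hy).1)]

end BondF

end Summit.CriticalPhenomena.PercolationContinuityZ3.Theorems.Pcint
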